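import Mathlib
import HarnessLib

/-!
# Segment counting for injective self-maps (grain rung of the `(111)` adhesion atom)

HONEST FRAMING. Part of the venture `Summits/Ventures/Crystal3D` (cell `crystal3d-full`), helper
`--supports` the crux `NoReconstructionGain` (stmt-Ventures-19144, route
`route-Ventures-StickyWulffConstant`), line `adhesion`, GRAIN RUNG: the atom at `ν = e₃` for
overlayers contained in one rigid-motion image of a Barlow stacking (any Hägg word, any
orientation).  This file is the abstract bookkeeping only (no geometry).

For a finite set `Q` and an injective map `T` (one of the six "transport families" of a
close-packed stacking: a lattice-line translation, or an interlayer chain step), the number of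
`q ∈ Q` whose successor `T q` is missing equals the number of `q ∈ Q` with no predecessor in `Q`
(`card_filter_succ_not_mem_eq`) — both count the maximal `T`-segments of `Q`.  If `T` does not
decrease a height function, a set `Ba ⊆ Q` of predecessor-free elements living above a level `m`
and a set `Bb ⊆ Q` of successor-free elements living below `m` are counted by DISTINCT segments:
`#Ba + #Bb ≤ #{q ∈ Q : T q ∉ Q}` (`card_add_card_le_card_filter_succ_not_mem`, and the mirror
version for non-increasing `T`).  In the grain rung, `Ba`/`Bb` are the overlayer balls touching
the top/bottom face of the slab sample, and each good family pays one unit of deficiency per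
toucher.

WHAT THIS IS NOT: anything about packings; rung F-C1 not moved.
-/

namespace Summit.Ventures.Crystal3D.Theorems

open Finset

variable {ι : Type*} [DecidableEq ι]

/-- For an injective map `T` and a finite set `Q`, the image under `T` of the elements of `Q`
whose successor stays in `Q` is `Q ∩ T(Q)`. -/
theorem image_filter_succ_mem_eq (Q : Finset ι) (T : ι → ι) :
    (Q.filter fun q => T q ∈ Q).image T = Q.image T ∩ Q := by
  ext x
  simp only [mem_image, mem_filter, mem_inter]
  constructor
  · rintro ⟨q, ⟨hq, hTq⟩, rfl⟩
    exact ⟨⟨q, hq, rfl⟩, hTq⟩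
  · rintro ⟨⟨q, hq, rfl⟩, hTq⟩
    exact ⟨q, ⟨hq, hTq⟩, rfl⟩

/-- **Segments have one top and one bottom.**  For an injective `T` and finite `Q`, the number of
`q ∈ Q` with `T q ∉ Q` (segment tops) equals the number of `q ∈ Q` that are not of the form `T x`,
`x ∈ Q` (segment bottoms). -/
theorem card_filter_succ_not_mem_eq (Q : Finset ι) (T : ι → ι) (hT : Function.Injective T) :
    (Q.filter fun q => T q ∉ Q).card = (Q.filter fun q => q ∉ Q.image T).card := by
  have h1 : (Q.filter fun q => T q ∈ Q).card + (Q.filter fun q => T q ∉ Q).card = Q.card :=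
    card_filter_add_card_filter_not _
  have h2 : (Q.filter fun q => q ∈ Q.image T).card + (Q.filter fun q => q ∉ Q.image T).card =
      Q.card := card_filter_add_card_filter_not _
  have h3 : (Q.filter fun q => T q ∈ Q).card = (Q.filter fun q => q ∈ Q.image T).card := by
    rw [← card_image_of_injective (Q.filter fun q => T q ∈ Q) hT, image_filter_succ_mem_eq]
    congr 1
    ext x
    simp only [mem_inter, mem_filter]
    tauto
  omega

/-- **Touchers above and below are counted by distinct segments (non-decreasing family).**
`T` injective and non-decreasing for a height `ht`; `Ba ⊆ Q` predecessor-free elements at height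
`≥ m`, `Bb ⊆ Q` successor-free elements at height `< m`.  Then `#Ba + #Bb ≤ #{q ∈ Q : T q ∉ Q}`. -/
theorem card_add_card_le_card_filter_succ_not_mem (Q : Finset ι) (T : ι → ι)
    (hT : Function.Injective T) (ht : ι → ℝ) (m : ℝ) (hmono : ∀ x, ht x ≤ ht (T x))
    (Ba Bb : Finset ι) (hBa : Ba ⊆ Q) (hBb : Bb ⊆ Q)
    (hBa_hi : ∀ q ∈ Ba, m ≤ ht q) (hBb_lo : ∀ q ∈ Bb, ht q < m)
    (hBa_pred : ∀ q ∈ Ba, ∀ x ∈ Q, T x ≠ q) (hBb_succ : ∀ q ∈ Bb, T q ∉ Q) :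
    Ba.card + Bb.card ≤ (Q.filter fun q => T q ∉ Q).card := by
  set Qhi := Q.filter fun q => m ≤ ht q with hQhi
  -- the high part is closed under successors inside `Q`
  have hclosed : (Qhi.filter fun q => T q ∉ Q) = Qhi.filter fun q => T q ∉ Qhi := by
    refine filter_congr fun q hq => ?_
    rw [hQhi, mem_filter] at hq ⊢
    constructor
    · intro h hmem; exact h hmem.1
    · intro h hmem; exact h ⟨hmem, le_trans hq.2 (hmono q)⟩
  -- `Ba` sits among the bottoms of the high part
  have hBa_le : Ba.card ≤ (Qhi.filter fun q => T q ∉ Qhi).card := by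
    rw [card_filter_succ_not_mem_eq Qhi T hT]
    refine card_le_card fun q hq => ?_
    rw [mem_filter]
    refine ⟨by rw [hQhi, mem_filter]; exact ⟨hBa hq, hBa_hi q hq⟩, ?_⟩
    intro himg
    obtain ⟨x, hx, hxq⟩ := mem_image.1 himg
    exact hBa_pred q hq x (mem_filter.1 hx).1 hxq
  -- the two groups of tops are disjoint subsets of the tops of `Q`
  have hsub : (Qhi.filter fun q => T q ∉ Q) ∪ Bb ⊆ Q.filter fun q => T q ∉ Q := by
    intro q hq
    rw [mem_filter]
    rcases mem_union.1 hq with h | h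
    · rw [mem_filter, hQhi, mem_filter] at h
      exact ⟨h.1.1, h.2⟩
    · exact ⟨hBb h, hBb_succ q h⟩
  have hdisj : Disjoint (Qhi.filter fun q => T q ∉ Q) Bb := by
    rw [disjoint_left]
    intro q hq hqb
    rw [mem_filter, hQhi, mem_filter] at hq
    exact absurd hq.1.2 (not_le.2 (hBb_lo q hqb))
  calc Ba.card + Bb.card ≤ (Qhi.filter fun q => T q ∉ Qhi).card + Bb.card :=
        Nat.add_le_add_right hBa_le _
    _ = ((Qhi.filter fun q => T q ∉ Q) ∪ Bb).card := by
        rw [← hclosed, card_union_of_disjoint hdisj]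
    _ ≤ (Q.filter fun q => T q ∉ Q).card := card_le_card hsub

/-- **Mirror version (non-increasing family).** `T` injective and non-increasing for `ht`;
`Ba ⊆ Q` successor-free elements at height `> m`, `Bb ⊆ Q` predecessor-free elements at height
`≤ m`.  Then `#Ba + #Bb ≤ #{q ∈ Q : T q ∉ Q}`. -/
theorem card_add_card_le_card_filter_succ_not_mem' (Q : Finset ι) (T : ι → ι)
    (hT : Function.Injective T) (ht : ι → ℝ) (m : ℝ) (hanti : ∀ x, ht (T x) ≤ ht x)
    (Ba Bb : Finset ι) (hBa : Ba ⊆ Q) (hBb : Bb ⊆ Q)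
    (hBa_hi : ∀ q ∈ Ba, m < ht q) (hBb_lo : ∀ q ∈ Bb, ht q ≤ m)
    (hBa_succ : ∀ q ∈ Ba, T q ∉ Q) (hBb_pred : ∀ q ∈ Bb, ∀ x ∈ Q, T x ≠ q) :
    Ba.card + Bb.card ≤ (Q.filter fun q => T q ∉ Q).card := by
  have := card_add_card_le_card_filter_succ_not_mem Q T hT (fun x => -ht x) (-m)
    (fun x => neg_le_neg (hanti x)) Bb Ba hBb hBa
    (fun q hq => neg_le_neg (hBb_lo q hq)) (fun q hq => neg_lt_neg (hBa_hi q hq))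
    hBb_pred hBa_succ
  omega

end Summit.Ventures.Crystal3D.Theorems
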